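import Summits.CriticalPhenomena.PercolationContinuityZ3.Theorems.SahiMasterFamilyExpectationRigidity

/-!
# Rigidity R₃, preliminaries: polynomial bookkeeping along one coordinate, sections of real functions, the four-point obstruction

Support file of the master-family programme (crux `NoHeavyLowerTail`, stmt-CriticalPhenomena-4575; cell `prim-masterthm`, seat P4,
unit `prim-masterthm-p4-g7`).  Seat document HOME/prim-masterthm-p4/EQI3-RIGIDITY-PROOF.md §0, §3.  First of three files proving THEOREM R₃
(`SahiMasterFamilyRigidityR3`).  Contents: `mvpoly_eq_of_eval_eq` (bounded-degree polynomials agreeing on the open cube are equal),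
`exPoly_add/sub`, `degreeOf_exPoly_eq_zero_of_ignores` (an `e`-free function has an `e`-free expectation polynomial), `exPoly_xInd_mul`
(`E(x_e g) = X_e E(g)`), sections `fsec`/`dsec` of real functions with `E(h) = E(h₀) + X_e E(h₁ − h₀)` (`exPoly_eq_fsec`), the degree tricks
`eq_zero_of_X_sq_mul_eq` / `eq_zero_of_X_mul_eq`, dependence on a coordinate set (`apply_eq_of_inter_eq`), independence of events with disjoint
essential supports in polynomial form (`exPoly_ind_mul_eq_of_ignores`), and the FOUR-POINT obstruction `four_point` (Fact 2 of the paper: no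
`{0,1}`-valued function has two simultaneously active, non-interacting coordinates at one point).
HONEST FRAMING: infrastructure; Sahi `C_k` / Kahn's Conj. 5 / the master theorem remain OPEN.  [this work]
-/

noncomputable section

open scoped Classical

namespace Summit.CriticalPhenomena.PercolationContinuityZ3.Theorems

open Finset Function MvPolynomial
open Literature.Computability.AlgebraicComplexity (blockProfile blockProfile_apply)
open Literature.Combinatorics.Sahi2008
open Literature.Probability.Percolation.BHK2006 (weight)
open Literature.Probability.Percolation.DecisionTree (ind ind_of_mem ind_of_not_mem ind_nonneg)
open SharedCoordinate (Ignores xInd)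
open ExpectationRigidity

namespace RigidityR3

variable {ι : Type*} [Fintype ι]

/-! ### Polynomial bookkeeping -/

/-- Two polynomials of bounded degree agreeing on the open cube are equal. [folklore] -/
theorem mvpoly_eq_of_eval_eq {P Q : MvPolynomial ι ℝ} (d : ℕ) (hP : ∀ e, degreeOf e P ≤ d) (hQ : ∀ e, degreeOf e Q ≤ d)
    (h : ∀ x : ι → ℝ, (∀ e, x e ∈ Set.Ioo (0 : ℝ) 1) → eval x P = eval x Q) : P = Q := by
  refine sub_eq_zero.1 (eq_zero_of_eval_zero_at_prod_finset _ (fun _ => gridPts d) (fun e => ?_) fun x hx => ?_)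
  · rw [card_gridPts]; exact (degreeOf_sub_le e _ _).trans_lt (by have := hP e; have := hQ e; omega)
  · rw [map_sub, sub_eq_zero]; exact h x fun e => mem_Ioo_of_mem_gridPts (hx e)

/-- `exPoly` is additive. [this work] -/
theorem exPoly_add (f g : Set ι → ℝ) : exPoly (f + g) = exPoly f + exPoly g := by
  simp only [exPoly, Pi.add_apply, map_add, add_mul, sum_add_distrib]

/-- `exPoly` is compatible with subtraction. [this work] -/
theorem exPoly_sub (f g : Set ι → ℝ) : exPoly (f - g) = exPoly f - exPoly g := by
  simp only [exPoly, Pi.sub_apply, map_sub, sub_mul, sum_sub_distrib]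

/-- `exPoly f = 0 ↔ f = 0`. [this work] -/
theorem exPoly_eq_zero_iff {f : Set ι → ℝ} : exPoly f = 0 ↔ f = 0 := by
  constructor
  · intro h; funext ω; have := eval_exPoly_vtx ω f; rw [h, map_zero] at this; exact this.symm
  · rintro rfl; simp [exPoly]

/-- An `e`-free function is determined by `univ.erase e`. [this work] -/
theorem dep_erase_of_ignores {e : ι} {g : Set ι → ℝ} (hg : Ignores e g) :
    ∀ ω ω' : Set ι, ω ∩ ↑(univ.erase e) = ω' ∩ ↑(univ.erase e) → g ω = g ω' := by
  intro ω ω' h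
  have hωe : ω \ {e} = ω' \ {e} := by
    ext i
    have := Set.ext_iff.1 h i
    simp only [Set.mem_inter_iff, mem_coe, mem_erase, mem_univ, and_true, Set.mem_sdiff, Set.mem_singleton_iff] at this ⊢
    tauto
  rw [← hg.sdiff ω, hωe, hg.sdiff ω']

/-- **An `e`-free function has an `e`-free expectation polynomial.** [this work] -/
theorem degreeOf_exPoly_eq_zero_of_ignores {e : ι} {g : Set ι → ℝ} (hg : Ignores e g) : degreeOf e (exPoly g) = 0 := by
  refine Nat.eq_zero_of_le_zero ((degreeOf_le_iff).2 fun m hm => ?_)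
  obtain ⟨T, rfl, hT⟩ := exists_of_mem_support_exPoly hm
  rw [blockProfile_apply]
  split_ifs with heT
  · exact absurd (mobCoeff_eq_zero_of_not_subset (dep_erase_of_ignores hg) fun h => by simpa using h heT) hT
  · exact le_rfl

/-- `y` is essential for `f` iff `deg_y E(f) ≠ 0`; here the direction "inessential ⇐ degree 0" packaged contrapositively. [this work] -/
theorem degreeOf_exPoly_eq_one_of_not_ignores {e : ι} {g : Set ι → ℝ} (hg : ¬ Ignores e g) : degreeOf e (exPoly g) = 1 :=
  le_antisymm (degreeOf_exPoly_le g e) (Nat.one_le_iff_ne_zero.2 fun h => hg (ignores_of_degreeOf_exPoly_eq_zero h))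

/-- **`E(x_e g) = X_e · E(g)`** for `e`-free `g`. [this work] -/
theorem exPoly_xInd_mul {e : ι} {g : Set ι → ℝ} (hg : Ignores e g) :
    exPoly (xInd e * g) = X e * exPoly g := by
  refine mvpoly_eq_of_eval_eq 2 (fun i => (degreeOf_exPoly_le _ i).trans (by norm_num)) (fun i => ?_) fun x hx => ?_
  · refine (degreeOf_mul_le i _ _).trans ?_
    have h1 : degreeOf i (X e : MvPolynomial ι ℝ) ≤ 1 := by rw [degreeOf_X]; split_ifs <;> norm_num
    have h2 := degreeOf_exPoly_le g i
    omega
  · rw [map_mul, MvPolynomial.eval_X, eval_exPoly, eval_exPoly]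
    set p : ι → unitInterval := fun i => ⟨x i, (hx i).1.le, (hx i).2.le⟩ with hp
    have hw : weight x = bernoulliWeight p := rfl
    rw [hw, ← update_eq_self e p, SharedCoordinate.ex_update_xInd_mul p e (p e) hg, update_eq_self,
      ← SharedCoordinate.ex_eq_offEx p e hg]

/-! ### Sections of real functions -/

omit [Fintype ι] in
/-- Differences of `e`-free functions are `e`-free. [this work] -/
theorem ignores_sub {e : ι} {g h : Set ι → ℝ} (hg : Ignores e g) (hh : Ignores e h) : Ignores e (g - h) := fun ω => by
  rw [Pi.sub_apply, Pi.sub_apply, hg ω, hh ω]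

/-- The `b`-section `ω ↦ h(ω with e forced to b)` of a real function (`e`-free). [this work] -/
def fsec (e : ι) (b : Bool) (h : Set ι → ℝ) : Set ι → ℝ := fun ω => h (forceAt e b ω)

omit [Fintype ι] in
/-- Sections are `e`-free. [this work] -/
theorem ignores_fsec (e : ι) (b : Bool) (h : Set ι → ℝ) : Ignores e (fsec e b h) := fun ω => by
  simp only [fsec, forceAt_insert]

omit [Fintype ι] in
/-- **`h = h₀ + x_e (h₁ − h₀)`** with `h_b` the sections. [this work] -/
theorem eq_fsec_add_xInd_mul (e : ι) (h : Set ι → ℝ) : h = fsec e false h + xInd e * (fsec e true h - fsec e false h) := by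
  funext ω
  simp only [Pi.add_apply, Pi.mul_apply, Pi.sub_apply, fsec, forceAt, xInd, cond_true, cond_false]
  by_cases he : e ∈ ω
  · rw [if_pos he, Set.insert_eq_of_mem he]; ring
  · rw [if_neg he, Set.sdiff_singleton_eq_self he]; ring

omit [Fintype ι] in
/-- Sections of an `e`-free function are the function. [this work] -/
theorem fsec_of_ignores {e : ι} (b : Bool) {g : Set ι → ℝ} (hg : Ignores e g) : fsec e b g = g := by
  funext ω
  cases b
  · exact hg.sdiff ω
  · exact hg ω

omit [Fintype ι] in
/-- Sections of a product with an `e`-free factor. [this work] -/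
theorem fsec_mul_of_ignores {e : ι} (b : Bool) {g : Set ι → ℝ} (hg : Ignores e g) (h : Set ι → ℝ) :
    fsec e b (g * h) = g * fsec e b h := by
  funext ω
  show g (forceAt e b ω) * h (forceAt e b ω) = g ω * h (forceAt e b ω)
  rw [show g (forceAt e b ω) = fsec e b g ω from rfl, fsec_of_ignores b hg]

/-- **The expectation polynomial along `e`: `E(h) = E(h₀) + X_e · E(h₁ − h₀)`.** [this work] -/
theorem exPoly_eq_fsec (e : ι) (h : Set ι → ℝ) :
    exPoly h = exPoly (fsec e false h) + X e * exPoly (fsec e true h - fsec e false h) := by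
  conv_lhs => rw [eq_fsec_add_xInd_mul e h]
  rw [exPoly_add, exPoly_xInd_mul (ignores_sub (ignores_fsec e true h) (ignores_fsec e false h))]

/-- The difference of sections `h₁ − h₀` as a named `e`-free function ("signed pivotal function"). [this work] -/
def dsec (e : ι) (h : Set ι → ℝ) : Set ι → ℝ := fsec e true h - fsec e false h

omit [Fintype ι] in
/-- `dsec` is `e`-free. [this work] -/
theorem ignores_dsec (e : ι) (h : Set ι → ℝ) : Ignores e (dsec e h) := fun ω => by
  simp only [dsec, Pi.sub_apply, ignores_fsec e true h ω, ignores_fsec e false h ω]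

omit [Fintype ι] in
/-- `e` is inessential for `h` iff `dsec e h = 0`. [this work] -/
theorem ignores_iff_dsec_eq_zero (e : ι) (h : Set ι → ℝ) : Ignores e h ↔ dsec e h = 0 := by
  constructor
  · intro hh; funext ω; simp only [dsec, Pi.sub_apply, Pi.zero_apply, fsec, forceAt, cond_true, cond_false, hh ω, hh.sdiff ω, sub_self]
  · intro h0 ω
    by_cases he : e ∈ ω
    · rw [Set.insert_eq_of_mem he]
    · have := congrFun h0 ω
      simp only [dsec, Pi.sub_apply, Pi.zero_apply, fsec, forceAt, cond_true, cond_false, sub_eq_zero] at this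
      rw [this, Set.sdiff_singleton_eq_self he]

/-! ### Degree tricks in one variable -/

omit [Fintype ι] in
/-- `X_e`-degree of a product with an `e`-free nonzero factor. [this work] -/
theorem degreeOf_X_pow_mul {e : ι} {c : MvPolynomial ι ℝ} (hc : c ≠ 0) (hc0 : degreeOf e c = 0) (k : ℕ) :
    degreeOf e (X e ^ k * c) = k := by
  induction k with
  | zero => rw [pow_zero, one_mul, hc0]
  | succ k ih =>
    have hne : X e ^ k * c ≠ 0 := mul_ne_zero (pow_ne_zero _ (X_ne_zero e)) hc
    rw [pow_succ, mul_comm (X e ^ k), mul_assoc, degreeOf_mul_eq (X_ne_zero e) hne, ih, degreeOf_X, if_pos rfl, add_comm]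

omit [Fintype ι] in
/-- **If `c₀ + X_e c₁ + X_e² c₂ = 0` with `e`-free `c₀, c₁` (degree `≤ 1` for the combination) then `c₂ = 0`** — in the form used below:
`X_e² · c = L` with `deg_e L ≤ 1` forces `c = 0`. [this work] -/
theorem eq_zero_of_X_sq_mul_eq {e : ι} {c L : MvPolynomial ι ℝ} (hc0 : degreeOf e c = 0) (hL : degreeOf e L ≤ 1) (h : X e ^ 2 * c = L) : c = 0 := by
  by_contra hc
  have := degreeOf_X_pow_mul hc hc0 2
  rw [h] at this
  omega

omit [Fintype ι] in
/-- `X_e · c = L` with `deg_e L = 0` forces `c = 0`. [this work] -/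
theorem eq_zero_of_X_mul_eq {e : ι} {c L : MvPolynomial ι ℝ} (hc0 : degreeOf e c = 0) (hL : degreeOf e L = 0) (h : X e * c = L) : c = 0 := by
  by_contra hc
  have := degreeOf_X_pow_mul hc hc0 1
  rw [pow_one, h] at this
  omega

/-! ### Dependence on a set of coordinates -/

omit [Fintype ι] in
/-- Removing finitely many ignored coordinates does not change the value. [this work] -/
theorem apply_eq_apply_sdiff_of_ignores {g : Set ι → ℝ} (T : Finset ι) (hT : ∀ y ∈ T, Ignores y g) (ω : Set ι) :
    g ω = g (ω \ ↑T) := by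
  induction T using Finset.induction_on with
  | empty => simp
  | insert a T haT ih =>
    have hset : ω \ (↑(insert a T) : Set ι) = (ω \ ↑T) \ {a} := by
      ext y; simp only [coe_insert, Set.mem_sdiff, Set.mem_insert_iff, mem_coe, Set.mem_singleton_iff]; tauto
    rw [hset, (hT a (mem_insert_self a T)).sdiff, ih fun y hy => hT y (mem_insert_of_mem hy)]

/-- **A function ignoring every coordinate outside `S` depends only on `ω ∩ S`.** [this work] -/
theorem apply_eq_apply_inter_of_ignores_off {S : Finset ι} {g : Set ι → ℝ} (hg : ∀ y, y ∉ S → Ignores y g) (ω : Set ι) :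
    g ω = g (ω ∩ ↑S) := by
  have h := apply_eq_apply_sdiff_of_ignores (univ.filter fun y => y ∉ S) (fun y hy => hg y (mem_filter.1 hy).2) ω
  rw [h]
  congr 1
  ext y
  simp only [Set.mem_sdiff, coe_filter, mem_univ, true_and, Set.mem_setOf_eq, not_not, Set.mem_inter_iff, mem_coe]

/-- Two configurations agreeing on `S` give the same value to a function ignoring everything outside `S`. [this work] -/
theorem apply_eq_of_inter_eq {S : Finset ι} {g : Set ι → ℝ} (hg : ∀ y, y ∉ S → Ignores y g) {ω ω' : Set ι} (h : ω ∩ ↑S = ω' ∩ ↑S) :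
    g ω = g ω' := by
  rw [apply_eq_apply_inter_of_ignores_off hg ω, apply_eq_apply_inter_of_ignores_off hg ω', h]

/-- **Events with disjoint essential supports are uncorrelated under every product measure** (polynomial form). [this work] -/
theorem exPoly_ind_mul_eq_of_ignores {A B : Set (Set ι)} (h : ∀ y, Ignores y (ind A) ∨ Ignores y (ind B)) :
    exPoly (ind A * ind B) = exPoly (ind A) * exPoly (ind B) := by
  set S : Finset ι := univ.filter fun y => ¬ Ignores y (ind A) with hS
  set T : Finset ι := univ.filter fun y => ¬ Ignores y (ind B) with hT
  have hST : Disjoint S T := by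
    rw [Finset.disjoint_left]
    intro y hyS hyT
    rcases h y with hy | hy
    · exact (mem_filter.1 hyS).2 hy
    · exact (mem_filter.1 hyT).2 hy
  have hA : Literature.Probability.Percolation.DeterminedBy A (↑S : Set ι) :=
    determinedBy_of_ind_dep fun ω => apply_eq_apply_inter_of_ignores_off (fun y hy => by
      by_contra hny; exact hy (mem_filter.2 ⟨mem_univ _, hny⟩)) ω
  have hB : Literature.Probability.Percolation.DeterminedBy B (↑T : Set ι) :=
    determinedBy_of_ind_dep fun ω => apply_eq_apply_inter_of_ignores_off (fun y hy => by
      by_contra hny; exact hy (mem_filter.2 ⟨mem_univ _, hny⟩)) ω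
  refine exPoly_mul_eq_of_forall_interior fun p _ => ?_
  have hmul : ind A * ind B = ind (A ∩ B) := by
    funext ω; exact (Literature.Probability.Percolation.BHK2006.ind_inter A B ω).symm
  rw [hmul, ex_bernoulliWeight_ind, ex_bernoulliWeight_ind, ex_bernoulliWeight_ind]
  exact Literature.Probability.LatticeModels.prodBernoulli_real_inter_of_determinedBy_disjoint p hST hA hB
    MeasurableSet.of_discrete MeasurableSet.of_discrete

/-! ### The four-point obstruction (Fact 2) -/

omit [Fintype ι] in
/-- **No `{0,1}`-valued function has two simultaneously active, non-interacting coordinates at one point.** [this work] -/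
theorem four_point {A : Set (Set ι)} {ζ : Set ι} {s t : ι}
    (hjs : ind A (insert s ζ) ≠ ind A ζ) (hjt : ind A (insert t ζ) ≠ ind A ζ)
    (hmix : ind A (insert s (insert t ζ)) - ind A (insert t ζ) = ind A (insert s ζ) - ind A ζ) : False := by
  have h01 : ∀ ω : Set ι, ind A ω = 0 ∨ ind A ω = 1 := fun ω => by
    by_cases hω : ω ∈ A
    · exact Or.inr (ind_of_mem hω)
    · exact Or.inl (ind_of_not_mem hω)
  rcases h01 ζ with h0 | h0 <;> rcases h01 (insert s ζ) with h1 | h1 <;> rcases h01 (insert t ζ) with h2 | h2 <;>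
    rcases h01 (insert s (insert t ζ)) with h3 | h3
  all_goals simp only [h0, h1, h2, h3, ne_eq, not_true_eq_false] at hjs hjt hmix
  all_goals norm_num at hmix

end RigidityR3

end Summit.CriticalPhenomena.PercolationContinuityZ3.Theorems
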